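import Mathlib
import HarnessLib
import Summits.HubbardSuperconductivity.HubbardSuperconductivity.Theorems.KLProgrammeKLRegimeAlphaFatScalars2
import Summits.HubbardSuperconductivity.HubbardSuperconductivity.Theorems.KLProgrammeKLRegimeSectorSlicePairWtFat

/-!
# Route `KLProgramme` — crux K3 ENGINE (stmt-HubbardSuperconductivity-20437) stub (b) conj. 2 «(c-D)² FAMILY TELESCOPE», brick (D5o): the SCALAR
# closed forms of the telescope — the weight radicand `Ŵ` in product form, `Ŵ(x₀) ≤ x₀²Ŵ`, the time condition from `π³σ³Θ_t ≤ 4`, and the fat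
# support count in closed form under the regime's lattice conditions

Cell `gate-hubbard-kl`, seat hubbard-kl-k3c3-p2 (g11); F1-DESIGN §10.

* `telW_le` — with `1/s₀ = M/(σΛβ)` and `σΛβ ≤ M`: `Ŵ ≤ (1048576·P_ρ·Λ/(σ·N))·(M/β)·N/Λ²` (the `hW` slot of `alphaProductWt_le`, any `N > 0`);
* `telW_ref_le` — `Ŵ(ρ/x₀, ρ₃/x₀) ≤ x₀²·Ŵ(ρ, ρ₃)` (`1 ≤ x₀`);
* `telTime_of_sigma` — the family piece's time condition `htime` from `θ_k = ϑ_k(2π/(βΛ_m))^k`, `Λ ≤ Λ_m`, `s₀·2M ≤ 2σΛβ`, `π³σ³Θ_t ≤ 4`;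
* `fatSupport_closed` — `N̄_s ≤ (128c₁c_ρ/(π²γ))·βL²Λ₁²/N` (`N = 2^{m+1}`, `Λ_m = 4Λ₁`) from `π ≤ Λ_mβ`, `2πN(N+½) ≤ L`, `γπ ≤ 2√2LΛ₁`
  (p3's `fatSupport_le` with its four slots discharged as in `…AlphaWtClosedDatum`).

Pure real-arithmetic bookkeeping; no definitions, no sorry. [folklore]
-/

noncomputable section

namespace Summit.HubbardSuperconductivity.HubbardSuperconductivity.Theorems.TorusFourierL2

set_option linter.dupNamespace false -- summit = problem name (single-conjunct summit), D-0017

open Real Literature.MathematicalPhysics.QuantumLattice Literature.MathematicalPhysics.QuantumLattice.BandSectorCounting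

/-- **`Ŵ` in product form.** [folklore] -/
theorem telW_le {s₀ σ Λ β M N ρ ρ₃ : ℝ} (hσ : 0 < σ) (hΛ : 0 < Λ) (hβ : 0 < β) (hM : 0 < M) (hN : 0 < N) (hρ : 0 < ρ) (hρ₃ : 0 < ρ₃)
    (hs₀ : s₀ = σ * Λ * β / M) (hs₀1 : σ * Λ * β ≤ M) :
    524288 * (1 / s₀ + 1) * ((1 + 4 * Real.sqrt 2) ^ 2 * ((2 * Real.sqrt 2 / ρ + 2) * (2 * Real.sqrt 2 / ρ₃ + 2)) + (1 / ρ + 1) ^ 2) ≤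
      (1048576 * ((1 + 4 * Real.sqrt 2) ^ 2 * ((2 * Real.sqrt 2 / ρ + 2) * (2 * Real.sqrt 2 / ρ₃ + 2)) + (1 / ρ + 1) ^ 2) * Λ / (σ * N)) *
        (M / β) * N / Λ ^ 2 := by
  have h1 : 1 / s₀ + 1 ≤ 2 * (M / (σ * Λ * β)) := by
    rw [hs₀, one_div_div]
    have : 1 ≤ M / (σ * Λ * β) := by rw [le_div_iff₀ (by positivity)]; linarith
    linarith
  have hP : 0 ≤ (1 + 4 * Real.sqrt 2) ^ 2 * ((2 * Real.sqrt 2 / ρ + 2) * (2 * Real.sqrt 2 / ρ₃ + 2)) + (1 / ρ + 1) ^ 2 := by positivity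
  calc _ ≤ 524288 * (2 * (M / (σ * Λ * β))) * ((1 + 4 * Real.sqrt 2) ^ 2 * ((2 * Real.sqrt 2 / ρ + 2) * (2 * Real.sqrt 2 / ρ₃ + 2)) + (1 / ρ + 1) ^ 2) :=
        mul_le_mul_of_nonneg_right (mul_le_mul_of_nonneg_left h1 (by norm_num)) hP
    _ = _ := by field_simp; norm_num

/-- **`Ŵ` at the reference scale: `Ŵ(ρ/x₀, ρ₃/x₀) ≤ x₀²·Ŵ(ρ, ρ₃)`.** [folklore] -/
theorem telW_ref_le {s₀ x₀ ρ ρ₃ : ℝ} (hs₀ : 0 < s₀) (hx₀ : 1 ≤ x₀) (hρ : 0 < ρ) (hρ₃ : 0 < ρ₃) :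
    524288 * (1 / s₀ + 1) * ((1 + 4 * Real.sqrt 2) ^ 2 * ((2 * Real.sqrt 2 / (ρ / x₀) + 2) * (2 * Real.sqrt 2 / (ρ₃ / x₀) + 2)) + (1 / (ρ / x₀) + 1) ^ 2) ≤
      x₀ ^ 2 * (524288 * (1 / s₀ + 1) * ((1 + 4 * Real.sqrt 2) ^ 2 * ((2 * Real.sqrt 2 / ρ + 2) * (2 * Real.sqrt 2 / ρ₃ + 2)) + (1 / ρ + 1) ^ 2)) := by
  have hx0 : 0 < x₀ := lt_of_lt_of_le one_pos hx₀
  have i1 : 2 * Real.sqrt 2 / (ρ / x₀) + 2 ≤ x₀ * (2 * Real.sqrt 2 / ρ + 2) := by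
    rw [div_div_eq_mul_div, show x₀ * (2 * Real.sqrt 2 / ρ + 2) = 2 * Real.sqrt 2 * x₀ / ρ + 2 * x₀ by ring]
    linarith only [hx₀]
  have i2 : 2 * Real.sqrt 2 / (ρ₃ / x₀) + 2 ≤ x₀ * (2 * Real.sqrt 2 / ρ₃ + 2) := by
    rw [div_div_eq_mul_div, show x₀ * (2 * Real.sqrt 2 / ρ₃ + 2) = 2 * Real.sqrt 2 * x₀ / ρ₃ + 2 * x₀ by ring]
    linarith only [hx₀]
  have i3 : (1 / (ρ / x₀) + 1) ^ 2 ≤ x₀ ^ 2 * (1 / ρ + 1) ^ 2 := by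
    rw [← mul_pow]
    apply pow_le_pow_left₀ (by positivity)
    rw [one_div_div, show x₀ * (1 / ρ + 1) = x₀ / ρ + x₀ by ring]
    linarith only [hx₀]
  have i12 : (2 * Real.sqrt 2 / (ρ / x₀) + 2) * (2 * Real.sqrt 2 / (ρ₃ / x₀) + 2) ≤ x₀ ^ 2 * ((2 * Real.sqrt 2 / ρ + 2) * (2 * Real.sqrt 2 / ρ₃ + 2)) := by
    calc _ ≤ (x₀ * (2 * Real.sqrt 2 / ρ + 2)) * (x₀ * (2 * Real.sqrt 2 / ρ₃ + 2)) := mul_le_mul i1 i2 (by positivity) (by positivity)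
      _ = _ := by ring
  have h0 : 0 ≤ 524288 * (1 / s₀ + 1) := by positivity
  calc _ ≤ 524288 * (1 / s₀ + 1) * ((1 + 4 * Real.sqrt 2) ^ 2 * (x₀ ^ 2 * ((2 * Real.sqrt 2 / ρ + 2) * (2 * Real.sqrt 2 / ρ₃ + 2))) + x₀ ^ 2 * (1 / ρ + 1) ^ 2) := by
        gcongr
    _ = _ := by ring

set_option maxHeartbeats 1600000 in
/-- **The time condition of the family piece from `π³σ³Θ_t ≤ 4`.** [folklore] -/
theorem telTime_of_sigma {c Λ lam β e₀ d s₀ P2M σ κ qt₁ qt₂ qt₃ Dt₁ Dt₂ θ₁ θ₂ θ₃ B₁ B₂ B₃ : ℝ}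
    (hc : 0 < c) (hΛ : 0 < Λ) (hΛlam : Λ ≤ lam) (hβ : 0 < β) (hd : 0 ≤ d) (hs₀ : 0 < s₀) (hP2M : 0 < P2M) (hσ : 0 < σ)
    (hsM : s₀ * P2M ≤ 2 * σ * Λ * β) (hB₁ : 0 ≤ B₁) (hB₂ : 0 ≤ B₂) (hκ : κ = e₀ ^ 2 / lam ^ 2)
    (hqt₁ : qt₁ = 2 * (d * e₀ ^ 2) * |2 * π / β| / lam) (hqt₂ : qt₂ = (4 * (d * e₀ ^ 4) + 2 * (d * e₀ ^ 2)) * (2 * π / β) ^ 2 / lam ^ 2)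
    (hqt₃ : qt₃ = (8 * (d * e₀ ^ 6) + 12 * (d * e₀ ^ 4)) * |2 * π / β| ^ 3 / lam ^ 3)
    (hDt₁ : Dt₁ = 2 * lam * |2 * π / β|) (hDt₂ : Dt₂ = 2 * (2 * π / β) ^ 2)
    (hθ₁ : θ₁ = κ * Dt₁ + qt₁) (hθ₂ : θ₂ = κ ^ 2 * Dt₁ ^ 2 + κ * Dt₂ + 2 * (κ * Dt₁) * qt₁ + qt₂)
    (hθ₃ : θ₃ = κ ^ 3 * Dt₁ ^ 3 + 3 * (κ ^ 2 * (Dt₁ * Dt₂)) + 3 * ((κ ^ 2 * Dt₁ ^ 2 + κ * Dt₂) * qt₁) + 3 * (κ * Dt₁ * qt₂) + qt₃)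
    (hΘ : π ^ 3 * σ ^ 3 * ((64 * B₃ + 480 * B₂ + 1728 * B₁ + 1536) + 3 * (2 * e₀ ^ 2 + 2 * (d * e₀ ^ 2)) * (32 * B₂ + 144 * B₁ + 128) +
      3 * (4 * e₀ ^ 4 + 2 * e₀ ^ 2 + 8 * (d * e₀ ^ 4) + (4 * (d * e₀ ^ 4) + 2 * (d * e₀ ^ 2))) * (16 * B₁ + 16) +
      4 * (8 * e₀ ^ 6 + 12 * e₀ ^ 4 + 6 * (d * e₀ ^ 2) * (4 * e₀ ^ 4 + 2 * e₀ ^ 2) + 6 * e₀ ^ 2 * (4 * (d * e₀ ^ 4) + 2 * (d * e₀ ^ 2)) +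
        (8 * (d * e₀ ^ 6) + 12 * (d * e₀ ^ 4)))) ≤ 4) :
    (1 / c) ^ 2 *
        (1 * ((2 * π / β) ^ 3 * ((64 * B₃ + 480 * B₂ + 1728 * B₁ + 1536) * c / Λ ^ 4)) +
          3 * (θ₁ * ((2 * π / β) ^ 2 * ((32 * B₂ + 144 * B₁ + 128) * c / Λ ^ 3))) +
          3 * (θ₂ * ((2 * π / β) * ((16 * B₁ + 16) * c / Λ ^ 2))) +
          θ₃ * (4 * c / Λ)) ≤
      (1 / c) ^ 2 * (4 * c / Λ) * (4 / (s₀ * P2M)) ^ 3 := by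
  have hπ := Real.pi_pos
  have hlam : 0 < lam := hΛ.trans_le hΛlam
  have hab : |2 * π / β| = 2 * π / β := abs_of_pos (by positivity)
  set u : ℝ := 2 * π / β / lam with hu
  have hu0 : 0 < u := by positivity
  -- the exact homogeneity `θ_k = ϑ_k u^k`
  have e1 : θ₁ = (2 * e₀ ^ 2 + 2 * (d * e₀ ^ 2)) * u := by rw [hθ₁, hκ, hDt₁, hqt₁, hab, hu]; field_simp
  have e2 : θ₂ = (4 * e₀ ^ 4 + 2 * e₀ ^ 2 + 8 * (d * e₀ ^ 4) + (4 * (d * e₀ ^ 4) + 2 * (d * e₀ ^ 2))) * u ^ 2 := by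
    rw [hθ₂, hκ, hDt₁, hDt₂, hqt₁, hqt₂, hab, hu]; field_simp; ring
  have e3 : θ₃ = (8 * e₀ ^ 6 + 12 * e₀ ^ 4 + 6 * (d * e₀ ^ 2) * (4 * e₀ ^ 4 + 2 * e₀ ^ 2) + 6 * e₀ ^ 2 * (4 * (d * e₀ ^ 4) + 2 * (d * e₀ ^ 2)) +
      (8 * (d * e₀ ^ 6) + 12 * (d * e₀ ^ 4))) * u ^ 3 := by
    rw [hθ₃, hκ, hDt₁, hDt₂, hqt₁, hqt₂, hqt₃, hab, hu]; field_simp; ring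
  set K1 : ℝ := 16 * B₁ + 16 with hK1
  set K2 : ℝ := 32 * B₂ + 144 * B₁ + 128 with hK2
  set K3 : ℝ := 64 * B₃ + 480 * B₂ + 1728 * B₁ + 1536 with hK3
  set ϑ₁ : ℝ := 2 * e₀ ^ 2 + 2 * (d * e₀ ^ 2) with hϑ₁
  set ϑ₂ : ℝ := 4 * e₀ ^ 4 + 2 * e₀ ^ 2 + 8 * (d * e₀ ^ 4) + (4 * (d * e₀ ^ 4) + 2 * (d * e₀ ^ 2)) with hϑ₂
  set ϑ₃ : ℝ := 8 * e₀ ^ 6 + 12 * e₀ ^ 4 + 6 * (d * e₀ ^ 2) * (4 * e₀ ^ 4 + 2 * e₀ ^ 2) + 6 * e₀ ^ 2 * (4 * (d * e₀ ^ 4) + 2 * (d * e₀ ^ 2)) +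
    (8 * (d * e₀ ^ 6) + 12 * (d * e₀ ^ 4)) with hϑ₃
  have hϑ₁0 : 0 ≤ ϑ₁ := by positivity
  have hϑ₂0 : 0 ≤ ϑ₂ := by positivity
  have hϑ₃0 : 0 ≤ ϑ₃ := by positivity
  -- divide out `(1/c)²·c·(2π/β)³`; left: polynomial in `1/Λ, 1/Λ_m` ≤ Θ_t/Λ⁴
  have il1 : 1 / lam ≤ 1 / Λ := one_div_le_one_div_of_le hΛ hΛlam
  have hLHS : (1 / c) ^ 2 * (1 * ((2 * π / β) ^ 3 * (K3 * c / Λ ^ 4)) + 3 * (ϑ₁ * u * ((2 * π / β) ^ 2 * (K2 * c / Λ ^ 3))) +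
        3 * (ϑ₂ * u ^ 2 * ((2 * π / β) * (K1 * c / Λ ^ 2))) + ϑ₃ * u ^ 3 * (4 * c / Λ)) ≤
      (1 / c) * (2 * π / β) ^ 3 * ((K3 + 3 * ϑ₁ * K2 + 3 * ϑ₂ * K1 + 4 * ϑ₃) / Λ ^ 4) := by
    have e : (1 / c) ^ 2 * (1 * ((2 * π / β) ^ 3 * (K3 * c / Λ ^ 4)) + 3 * (ϑ₁ * u * ((2 * π / β) ^ 2 * (K2 * c / Λ ^ 3))) +
          3 * (ϑ₂ * u ^ 2 * ((2 * π / β) * (K1 * c / Λ ^ 2))) + ϑ₃ * u ^ 3 * (4 * c / Λ)) =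
        (1 / c) * (2 * π / β) ^ 3 * (K3 * (1 / Λ) ^ 4 + 3 * ϑ₁ * K2 * ((1 / lam) * (1 / Λ) ^ 3) + 3 * ϑ₂ * K1 * ((1 / lam) ^ 2 * (1 / Λ) ^ 2) +
          4 * ϑ₃ * ((1 / lam) ^ 3 * (1 / Λ))) := by
      rw [hu]; field_simp
    rw [e]
    refine mul_le_mul_of_nonneg_left ?_ (by positivity)
    have hiΛ : 0 ≤ 1 / Λ := by positivity
    have hil : 0 ≤ 1 / lam := by positivity
    have v1 : (1 / lam) * (1 / Λ) ^ 3 ≤ (1 / Λ) ^ 4 := by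
      calc (1 / lam) * (1 / Λ) ^ 3 ≤ (1 / Λ) * (1 / Λ) ^ 3 := mul_le_mul_of_nonneg_right il1 (by positivity)
        _ = (1 / Λ) ^ 4 := by ring
    have v2 : (1 / lam) ^ 2 * (1 / Λ) ^ 2 ≤ (1 / Λ) ^ 4 := by
      calc (1 / lam) ^ 2 * (1 / Λ) ^ 2 ≤ (1 / Λ) ^ 2 * (1 / Λ) ^ 2 := mul_le_mul_of_nonneg_right (pow_le_pow_left₀ hil il1 2) (by positivity)
        _ = (1 / Λ) ^ 4 := by ring
    have v3 : (1 / lam) ^ 3 * (1 / Λ) ≤ (1 / Λ) ^ 4 := by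
      calc (1 / lam) ^ 3 * (1 / Λ) ≤ (1 / Λ) ^ 3 * (1 / Λ) := mul_le_mul_of_nonneg_right (pow_le_pow_left₀ hil il1 3) hiΛ
        _ = (1 / Λ) ^ 4 := by ring
    have e4 : (K3 + 3 * ϑ₁ * K2 + 3 * ϑ₂ * K1 + 4 * ϑ₃) / Λ ^ 4 = (K3 + 3 * ϑ₁ * K2 + 3 * ϑ₂ * K1 + 4 * ϑ₃) * (1 / Λ) ^ 4 := by
      field_simp
    rw [e4]
    have hK20 : 0 ≤ K2 := by positivity
    have hK10 : 0 ≤ K1 := by positivity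
    nlinarith only [v1, v2, v3, hϑ₁0, hϑ₂0, hϑ₃0, hK20, hK10, mul_nonneg (mul_nonneg hϑ₁0 hK20) (sub_nonneg.2 v1),
      mul_nonneg (mul_nonneg hϑ₂0 hK10) (sub_nonneg.2 v2), mul_nonneg hϑ₃0 (sub_nonneg.2 v3)]
  -- right: `(1/c)²(4c/Λ)(4/(s₀·2M))³ ≥ (1/c)·32/(σ³Λ⁴β³)`
  have hRHS : (1 / c) * (2 * π / β) ^ 3 * ((K3 + 3 * ϑ₁ * K2 + 3 * ϑ₂ * K1 + 4 * ϑ₃) / Λ ^ 4) ≤ (1 / c) ^ 2 * (4 * c / Λ) * (4 / (s₀ * P2M)) ^ 3 := by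
    have hsP : 0 < s₀ * P2M := by positivity
    have h4 : 4 / (2 * σ * Λ * β) ≤ 4 / (s₀ * P2M) := div_le_div_of_nonneg_left (by norm_num) hsP hsM
    have h43 : (4 / (2 * σ * Λ * β)) ^ 3 ≤ (4 / (s₀ * P2M)) ^ 3 := pow_le_pow_left₀ (by positivity) h4 3
    have step : (1 / c) * (2 * π / β) ^ 3 * ((K3 + 3 * ϑ₁ * K2 + 3 * ϑ₂ * K1 + 4 * ϑ₃) / Λ ^ 4) ≤ (1 / c) ^ 2 * (4 * c / Λ) * (4 / (2 * σ * Λ * β)) ^ 3 := by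
      have e : (1 / c) ^ 2 * (4 * c / Λ) * (4 / (2 * σ * Λ * β)) ^ 3 = (1 / c) * (32 / (σ ^ 3 * Λ ^ 4 * β ^ 3)) := by field_simp; ring
      have e' : (1 / c) * (2 * π / β) ^ 3 * ((K3 + 3 * ϑ₁ * K2 + 3 * ϑ₂ * K1 + 4 * ϑ₃) / Λ ^ 4) =
          (1 / c) * ((8 * π ^ 3 * (K3 + 3 * ϑ₁ * K2 + 3 * ϑ₂ * K1 + 4 * ϑ₃)) / (Λ ^ 4 * β ^ 3)) := by field_simp; ring
      rw [e, e']
      refine mul_le_mul_of_nonneg_left ?_ (by positivity)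
      rw [div_le_div_iff₀ (by positivity) (by positivity)]
      have hΘ' : π ^ 3 * σ ^ 3 * (K3 + 3 * ϑ₁ * K2 + 3 * ϑ₂ * K1 + 4 * ϑ₃) ≤ 4 := hΘ
      have hpos : 0 < Λ ^ 4 * β ^ 3 := by positivity
      nlinarith only [hΘ', hpos]
    exact step.trans (mul_le_mul_of_nonneg_left h43 (by positivity))
  rw [e1, e2, e3]
  exact hLHS.trans hRHS

/-- **The fat support count in closed form under the regime's lattice conditions** (p3's `fatSupport_le` with its slots discharged as in
`…AlphaWtClosedDatum`: `Λ₁N² = e₀`, `N ≥ 2`, `Λ_m = 4Λ₁`). [cite: BenfattoGiulianiMastropietro2006, §2.8 (2.81)] -/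
theorem fatSupport_closed {a b : ℝ} (B : BandBounds a b) {A e₀ Λ₁ Λm β L N ρf cρ c₁ Kp : ℝ} (hA : 0 ≤ A) (hγ : 0 < 2 * B.rhomin - 4 * A)
    (hDt : 0 < B.Dtmin - 2 * A) (he : 0 < e₀) (hΛ₁ : 0 < Λ₁) (hβ : 0 < β) (hL : 0 < L) (hN2 : 2 ≤ N) (hΛm : Λm = 4 * Λ₁) (hπβ : π ≤ Λm * β)
    (hNΛ : Λ₁ * N ^ 2 = e₀) {m : ℕ} (hw : sectorWidth (m + 1) = π / N)
    (hρf : ρf = (Λm + B.smax * B.Dtmin * (3 * sectorWidth (m + 1) / 4)) / (B.Dtmin - 2 * A) + π * Real.sqrt 2 * (1 + (4 + 2 * A) / (B.Dtmin - 2 * A)) * sectorWidth (m + 1))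
    (hcρ : cρ = (2 * e₀ / π + B.smax * B.Dtmin * (3 / 4)) / (B.Dtmin - 2 * A) + π * Real.sqrt 2 * (1 + (4 + 2 * A) / (B.Dtmin - 2 * A)))
    (hKp : Kp = 4 + 4 * A) (hc₁ : c₁ = 4 + Kp * cρ ^ 2 * π ^ 2 / e₀)
    (hLN : 2 * π * N * (N + 1 / 2) ≤ L) (hL1 : (2 * B.rhomin - 4 * A) * π ≤ 2 * Real.sqrt 2 * L * Λ₁) :
    (Λm * β / π + 1) * ((Real.sqrt 2 * L * ((Λm + (4 + 4 * A) * ρf ^ 2) / (2 * B.rhomin - 4 * A)) / π + 2) * (Real.sqrt 2 * L * (2 * ρf) / π + 2)) ≤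
      128 * c₁ * cρ / (π ^ 2 * (2 * B.rhomin - 4 * A)) * (β * L ^ 2 * Λ₁ ^ 2 / N) := by
  have hπ := Real.pi_pos
  have hsm := B.smax_pos
  have hdt := B.Dtmin_pos
  have hN : 0 < N := by linarith
  have hcρ0 : 0 ≤ cρ := by rw [hcρ]; positivity
  have hKp0 : 0 ≤ Kp := by rw [hKp]; positivity
  have hc₁0 : 0 ≤ c₁ := by rw [hc₁]; positivity
  have hρf0 : 0 ≤ ρf := by rw [hρf, hΛm]; have := sectorWidth_pos (m + 1); positivity
  -- `ρ_f ≤ c_ρ π/N` (`Λ_m = 4e₀/N² ≤ 2e₀/N`)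
  have hΛmN : Λm * N ≤ 2 * e₀ := by
    rw [hΛm, ← hNΛ]; nlinarith [hΛ₁, hN2]
  have hρfb : ρf ≤ cρ * π / N := by
    rw [hρf, hcρ, hw]
    have h4Λ : Λm ≤ 2 * e₀ / π * (π / N) := by
      rw [show 2 * e₀ / π * (π / N) = 2 * e₀ / N by field_simp, le_div_iff₀ hN]; exact hΛmN
    have e2 : ((2 * e₀ / π + B.smax * B.Dtmin * (3 / 4)) / (B.Dtmin - 2 * A) + π * Real.sqrt 2 * (1 + (4 + 2 * A) / (B.Dtmin - 2 * A))) * π / N =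
        (2 * e₀ / π * (π / N) + B.smax * B.Dtmin * (3 * (π / N) / 4)) / (B.Dtmin - 2 * A) +
          π * Real.sqrt 2 * (1 + (4 + 2 * A) / (B.Dtmin - 2 * A)) * (π / N) := by
      field_simp
    rw [e2]
    gcongr
  -- shell thickness `Λ_m + K_pρ_f² ≤ Λ₁c₁` (`(c_ρπ/N)² = c_ρ²π²Λ₁/e₀`)
  have hsh : Λm + Kp * ρf ^ 2 ≤ Λ₁ * c₁ := by
    rw [hΛm, hc₁]
    have h1 : ρf ^ 2 ≤ (cρ * π / N) ^ 2 := pow_le_pow_left₀ hρf0 hρfb 2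
    have h2 : Kp * ρf ^ 2 ≤ Kp * (cρ * π / N) ^ 2 := mul_le_mul_of_nonneg_left h1 hKp0
    have e : Λ₁ * (4 + Kp * cρ ^ 2 * π ^ 2 / e₀) = 4 * Λ₁ + Kp * (cρ * π / N) ^ 2 := by
      rw [← hNΛ]; field_simp
    rw [e]; linarith only [h2]
  -- the two cell-count thresholds
  have hY₁ : 2 ≤ Real.sqrt 2 * L * ((Λm + (4 + 4 * A) * ρf ^ 2) / (2 * B.rhomin - 4 * A)) / π := by
    have h1' : 2 ≤ Real.sqrt 2 * L * (Λm / (2 * B.rhomin - 4 * A)) / π := by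
      rw [hΛm, le_div_iff₀ hπ, mul_div_assoc', le_div_iff₀ hγ]; linarith only [hL1]
    refine h1'.trans ?_
    gcongr
    exact le_add_of_nonneg_right (by positivity)
  have hY₂ : 2 ≤ Real.sqrt 2 * L * (2 * ρf) / π := by
    have hlow : π * Real.sqrt 2 * (π / N) ≤ ρf := by
      rw [hρf, hw]
      have h1' : 0 ≤ (Λm + B.smax * B.Dtmin * (3 * (π / N) / 4)) / (B.Dtmin - 2 * A) := by rw [hΛm]; positivity
      have h2' : π * Real.sqrt 2 * (π / N) ≤ π * Real.sqrt 2 * (1 + (4 + 2 * A) / (B.Dtmin - 2 * A)) * (π / N) := by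
        have h1'' : (1 : ℝ) ≤ 1 + (4 + 2 * A) / (B.Dtmin - 2 * A) := by
          have : 0 ≤ (4 + 2 * A) / (B.Dtmin - 2 * A) := by positivity
          linarith only [this]
        have h2'' := mul_le_mul_of_nonneg_left h1'' (by positivity : 0 ≤ π * Real.sqrt 2 * (π / N))
        linarith only [h2'']
      linarith only [h1', h2']
    have hs2 : Real.sqrt 2 * Real.sqrt 2 = 2 := Real.mul_self_sqrt (by norm_num)
    have hLNr : N ≤ 2 * L := by
      have h1'' : 1 ≤ 2 * π * (N + 1 / 2) := by nlinarith only [Real.pi_gt_three, hN]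
      have h2'' : N ≤ 2 * π * N * (N + 1 / 2) := by
        calc N = N * 1 := (mul_one _).symm
          _ ≤ N * (2 * π * (N + 1 / 2)) := mul_le_mul_of_nonneg_left h1'' hN.le
          _ = 2 * π * N * (N + 1 / 2) := by ring
      linarith only [h2'', hLN, hL]
    rw [le_div_iff₀ hπ]
    calc 2 * π ≤ Real.sqrt 2 * L * (2 * (π * Real.sqrt 2 * (π / N))) := by
          rw [show Real.sqrt 2 * L * (2 * (π * Real.sqrt 2 * (π / N))) = (Real.sqrt 2 * Real.sqrt 2) * 2 * π * π * L / N by field_simp, hs2]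
          rw [le_div_iff₀ hN]
          have h1'' : 2 * π * N ≤ 2 * π * (2 * L) := mul_le_mul_of_nonneg_left hLNr (by positivity)
          have h2'' : 2 * π * (2 * L) ≤ 2 * 2 * π * π * L := by
            have h := mul_le_mul_of_nonneg_left (show (1 : ℝ) ≤ π by linarith only [Real.pi_gt_three])
              (by positivity : (0 : ℝ) ≤ 2 * 2 * π * L)
            linarith only [h]
          linarith only [h1'', h2'']
      _ ≤ Real.sqrt 2 * L * (2 * ρf) := by gcongr
  have h := fatSupport_le (Kp := 4 + 4 * A) hΛ₁ hβ hL hγ hN hc₁0 hΛm hπβ (by rw [← hKp]; exact hsh) hρfb (by positivity) hY₁ hY₂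
  exact h.trans (le_of_eq (by ring))

end Summit.HubbardSuperconductivity.HubbardSuperconductivity.Theorems.TorusFourierL2

end
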